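import Summits.ValiantsHypothesis.ValiantsHypothesis.Theorems.BarrierLeverPartitionMinorsHitByVPMooreBall
import Summits.ValiantsHypothesis.ValiantsHypothesis.Theorems.BarrierLeverPartitionMinorsHitByVPOfLowerSets

/-!
# Route BarrierLever — item `PartitionMinorsHitByVP` (stmt-ValiantsHypothesis-19717):
# for BALL ROWS, Frobenius certificates on DOWN-CLOSED column families already give ALL columns

Helper file (`--supports stmt-ValiantsHypothesis-19717`; cell valiant-natproofs, rung V4, 𝒟-side door (c); prover
seat val-np-p6 gen 6). Definition-free. Closes NO item.

The conjecture of record of the T1 line is F_3 (`MooreBallNonsingularChar 3 h e` of `…HitByVPMooreBall`, all `h e`):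
the characteristic-3 Moore determinant `det [η_{u i}^{Σ_{c∈w j} 3^c}]` is nonzero for ball rows and EVERY injective
column family `w`. Through val-np-p1 g12's witness-agnostic LOWER-SET REDUCTION (`DownCompression.iterate_y`: fix the
rows, compress the columns one coordinate at a time, each step multiplying the witness by a linear factor `1 + s·y_c`)
it is enough to certify the DOWN-CLOSED column families (simplicial complexes `w`, `IsLowerSet (Set.range w)`):

* **`partitionMinor_hit_ballRows_of_frobenius_lowerSets`** — fix a prime `p`, `h ≥ 4` and a radius `e`. If for every
  ball-row layout (rows through `B([h], e)` in any order) whose column family is injective AND DOWN-CLOSED the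
  characteristic-`p` Moore determinant is nonzero, then EVERY ball-row layout (any injective columns) is hit inside
  `SmallCircuits ℂ (h+h) 9` (additive witness of `…FrobeniusDoorCharP`, then `h` compression steps, then truncation to
  degree `2h`; size bookkeeping = `DownCompression.size_le_pow`).
* `partitionMinor_hit_ballColumns_of_frobenius_lowerSets` — the mirror class (any rows × ball columns).

So F_3 may be restricted to down-sets («F_3^{down}», seat memo RESIDUE-v8 §1): a smaller falsifier space (at `(6,2)`:
144 505 down-closed families instead of `C(64,22)`; kit j287869: F_3 holds on all of them) and the natural home of the
low-order peel of `…HitByVPMooreBallBall`. For down-closed `w` the determinant does not even depend on the constant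
variable `Y_none` (memo §1 (R1); not needed here).

WHAT THIS IS NOT: conditional arrows only (hypothesis = F_p on down-closed column families, OPEN beyond the ball itself and
`e ≤ 1`); exponent `9` instead of `5` is the price of the compression; nothing on crux 14610 or VP vs VNP.
-/

set_option linter.dupNamespace false

namespace Summit.ValiantsHypothesis.ValiantsHypothesis.Theorems.BarrierLever.FrobeniusDoor

open Finset MvPolynomial Matrix
open Literature.Barriers.ValiantsHypothesis Literature.Computability.AlgebraicComplexity
open Summit.ValiantsHypothesis.ValiantsHypothesis.Theorems.BarrierLever.AdditiveDoor
  (truncation_spec degree_partitionExpo_le partitionMinor_hit_of_additive_mem)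
open Summit.ValiantsHypothesis.ValiantsHypothesis.Theorems.BarrierLever.DownCompression (iterate_y size_le_pow)

noncomputable section

variable (p : ℕ) [Fact p.Prime]

/-- **Down-closed column families suffice for ball rows (Frobenius certificates).** `h ≥ 4`; if the
characteristic-`p` Moore determinant is nonzero for every layout «rows through the ball `B([h], e)` (any order) ×
injective DOWN-CLOSED columns», then every layout «rows through `B([h], e)` × ANY injective columns» is hit inside
`SmallCircuits ℂ (h+h) 9`. -/
theorem partitionMinor_hit_ballRows_of_frobenius_lowerSets {h e : ℕ} (hh : 4 ≤ h)
    (hF : ∀ (r : ℕ) (u w : Fin r → Finset (Fin h)), Function.Injective u → Function.Injective w →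
      (∀ i, (u i).card ≤ e) → (∀ S : Finset (Fin h), S.card ≤ e → ∃ i, u i = S) →
      IsLowerSet (Set.range w) →
      (Matrix.of fun i j : Fin r =>
        ((X none + ∑ a ∈ u i, X (some a) : MvPolynomial (Option (Fin h)) (ZMod p))) ^
          (∑ c ∈ w j, p ^ (c : ℕ))).det ≠ 0)
    {r : ℕ} (u w : Fin r → Finset (Fin h)) (hu : Function.Injective u) (hw : Function.Injective w)
    (hsmall : ∀ i, (u i).card ≤ e) (hall : ∀ S : Finset (Fin h), S.card ≤ e → ∃ i, u i = S) :
    ∃ f ∈ SmallCircuits ℂ (h + h) 9,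
      (Matrix.of fun i j : Fin r => MvPolynomial.coeff
        (∑ a ∈ u i, Finsupp.single (Fin.castAdd h a) 1 +
          ∑ c ∈ w j, Finsupp.single (Fin.natAdd h c) 1) f).det ≠ 0 := by
  have hh2 : 2 ≤ h := le_trans (by norm_num) hh
  -- the down-closed case, with explicit size `(2h)^5` and degree `2h`
  have hyp : ∀ w' : Fin r → Finset (Fin h), Function.Injective w' → IsLowerSet (Set.range w') →
      ∃ f : MvPolynomial (Fin (h + h)) ℂ, complexity f ≤ (h + h) ^ 5 ∧ f.totalDegree ≤ h + h ∧
        (Matrix.of fun i j : Fin r => MvPolynomial.coeff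
          (∑ a ∈ u i, Finsupp.single (Fin.castAdd h a) 1 +
            ∑ c ∈ w' j, Finsupp.single (Fin.natAdd h c) 1) f).det ≠ 0 := by
    intro w' hw' hlow
    obtain ⟨ω₀, ω, hdet⟩ := exists_table_of_frobenius_char p u w' (hF r u w' hu hw' hsmall hall hlow)
    obtain ⟨f, ⟨hfd, hfs⟩, hf⟩ := partitionMinor_hit_of_additive_mem h hh2 u w' ω₀ ω hdet
    exact ⟨f, hfs, hfd, hf⟩
  -- all column compressions (`m = h`: no residual compression hypothesis)
  obtain ⟨g, hgs, hgd, hg⟩ := iterate_y u ((h + h) ^ 5) (h + h) hyp h le_rfl w hw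
    (fun c hc => absurd hc (by omega))
  -- truncate back to degree `2h`
  obtain ⟨hdeg, hcoeff, hsize⟩ := truncation_spec g (h + h)
  refine ⟨∑ k ∈ Finset.range (h + h + 1), homogeneousComponent k g, ⟨hdeg, ?_⟩, ?_⟩
  · calc complexity (∑ k ∈ Finset.range (h + h + 1), homogeneousComponent k g)
        ≤ (h + h + 2) ^ 2 * complexity g + (h + h + 1) := hsize
      _ ≤ (h + h + 2) ^ 2 * ((h + h) ^ 5 + 6 * h) + (h + h + 1) := by gcongr; omega
      _ ≤ (h + h) ^ (5 + 4) := size_le_pow h 5 hh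
  · have hmat : (Matrix.of fun i j : Fin r => MvPolynomial.coeff
        (∑ a ∈ u i, Finsupp.single (Fin.castAdd h a) 1 +
          ∑ c ∈ w j, Finsupp.single (Fin.natAdd h c) 1)
        (∑ k ∈ Finset.range (h + h + 1), homogeneousComponent k g)) =
        Matrix.of fun i j : Fin r => MvPolynomial.coeff
          (∑ a ∈ u i, Finsupp.single (Fin.castAdd h a) 1 +
            ∑ c ∈ w j, Finsupp.single (Fin.natAdd h c) 1) g := by
      ext i j
      rw [Matrix.of_apply, Matrix.of_apply, hcoeff _ (degree_partitionExpo_le _ _)]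
    rw [hmat]
    exact hg

/-- **Mirror: down-closed ROW families suffice for ball COLUMNS.** Same hypothesis (Frobenius certificates for ball rows ×
down-closed columns), conclusion for the transposed class «ANY injective rows × columns through `B([h], e)`». -/
theorem partitionMinor_hit_ballColumns_of_frobenius_lowerSets {h e : ℕ} (hh : 4 ≤ h)
    (hF : ∀ (r : ℕ) (u w : Fin r → Finset (Fin h)), Function.Injective u → Function.Injective w →
      (∀ i, (u i).card ≤ e) → (∀ S : Finset (Fin h), S.card ≤ e → ∃ i, u i = S) →
      IsLowerSet (Set.range w) →
      (Matrix.of fun i j : Fin r =>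
        ((X none + ∑ a ∈ u i, X (some a) : MvPolynomial (Option (Fin h)) (ZMod p))) ^
          (∑ c ∈ w j, p ^ (c : ℕ))).det ≠ 0)
    {r : ℕ} (u w : Fin r → Finset (Fin h)) (hu : Function.Injective u) (hw : Function.Injective w)
    (hsmall : ∀ j, (w j).card ≤ e) (hall : ∀ S : Finset (Fin h), S.card ≤ e → ∃ j, w j = S) :
    ∃ f ∈ SmallCircuits ℂ (h + h) 9,
      (Matrix.of fun i j : Fin r => MvPolynomial.coeff
        (∑ a ∈ u i, Finsupp.single (Fin.castAdd h a) 1 +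
          ∑ c ∈ w j, Finsupp.single (Fin.natAdd h c) 1) f).det ≠ 0 :=
  AdditiveDoor.partitionMinor_hit_symm h 9 u w
    (partitionMinor_hit_ballRows_of_frobenius_lowerSets p hh hF w u hw hu hsmall hall)

end

end Summit.ValiantsHypothesis.ValiantsHypothesis.Theorems.BarrierLever.FrobeniusDoor
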